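import Mathlib
import Literature.MathematicalPhysics.QuantumFieldTheory.Balaban1983to89.B8Eq194CriterionTorus

/-!
# [B8] (1.91) vs [4] (3.163)–(3.165): Q′ΔN(Q′) = 0 with DIRICHLET boundary conditions on ∂Ω₀
# (cell GAPS G-B8-19 (c), part 3: the setting [4] p. 394 and [B8] (1.91) actually use)

statement-level skeleton of published theorems with citation tags; proofs where landed; nothing here is a claim
about the Yang–Mills mass gap

Seat p40 gen 8, Phase 2, B8 lane; third file of G-B8-19 (c) after `B8Eq194Criterion` (characterization `crit_iff`;
read its CONTEXT / ERRATUM / HONEST SCOPE first) and `B8Eq194CriterionTorus` (product rule `crit_pi_iff`, periodic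
classification).  Kind: located reading note, constants only — NOT an error of either paper.

WHY.  [4] p. 394, the printed sentences (verbatim, p0006 L20–21, L24–25, L27–29, L33–34): «The operator Δ^η_U↾Ω₀
is the covariant Laplace operator with Dirichlet boundary conditions on Ω₀^c.»; «We will use only Dirichlet boundary
conditions. Let us introduce a domain Ω₀ such that Ω₁ ⊂ Ω₀ and Ω₀ is a union of big blocks of the lattice T₁»;
«For such Ω₀ we consider the operator Δ′_a with Dirichlet boundary conditions on ∂Ω₀, i.e. the operator
Δ′_a↾Ω₀ = Ω₀Δ′_aΩ₀.»; «All operators we will consider will be defined by using Dirichlet boundary conditions on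
Ω₀.»  (v1.0 of this header condensed these four sentences into one guillemet block — a paraphrase inside a
quotation, REFEREE-P2 note S-B8-g33-1; v1.1 quotes them separately.)  The H′ of [B8] (1.91) and of [4] (3.163) are
built from this Δ (through G′ = (Δ′_a)⁻¹).  The periodic classification of part 2 (criterion ⟺ L = 1 ∨ K = 1 ∨
(L, K) = (2, 2)) is therefore not yet the relevant one; this file classifies the DIRICHLET case and thereby
kernel-checks the second half («… or leaves Ω₀») of the by-hand clause of `B8Eq194FirstTerm` §2.

VERSIONS.  v1.0 = p302082 (p40 gen 8).  v1.1 (p40 gen 12): this WHY paragraph only (docstring); every declaration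
byte-identical to v1.0.

CONTENT (scalar model 𝔤 = ℝ, flat background).  Dirichlet chain Ω₀ = {0, …, N − 1} ⊂ ℤ: bond weights `pathW N`
(nearest neighbours inside Ω₀), diagonal term `endM N` (m(x) = number of bonds of ℤ leaving Ω₀ at x), so that
`lap (pathW N) (endM N)` is the one-dimensional Laplacian with Dirichlet boundary conditions on ∂Ω₀; blocks of L
consecutive sites `cycBlk L`, N = LK.  `crit_dir_one` (L = 1: holds), `crit_dir_two_one` (Ω₀ = one block of two
sites: HOLDS, m ≡ 1), **`not_crit_dir_single`** (Ω₀ = one block of L ≥ 3 sites: FAILS — m is not constant on the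
block; the three-site case is [4] p. 394's example, `not_crit_dir_three_sites`, same system as
`B8Eq194Criterion.not_crit_dirichlet3`), **`not_crit_dir_three`** (L ≥ 3, K ≥ 2: FAILS), **`not_crit_dir_two`**
(L = 2, K ≥ 2: FAILS — no 4-cycle exception without wrap-around), assembled in
**`crit_dir_chain_iff`: Q′ΔN(Q′) = 0 ⟺ L = 1 ∨ (L, K) = (2, 1)**, and, by the product rule, on the Dirichlet boxes
Ω₀ = {0, …, LK − 1}^ι ⊂ ℤ^ι (ι ≠ ∅ finite; Kronecker-sum = d-dimensional nearest-neighbour Laplacian with Dirichlet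
boundary conditions, diagonal term Σ_i m(x_i); K^d cubic blocks of side L): **`crit_dir_box_iff`** — the same.

UPSHOT for G-B8-19 (b).  In the geometry of (1.91)/(3.163) — Dirichlet boundary conditions on ∂Ω₀, blocks of side
L ≥ 2 — the criterion fails, hence (1.91)'s H′ ≠ [4]'s H′ (`B8Eq194FirstTerm.H4_eq_Hp_of_criterion`, a onto), for
EVERY number K^d ≥ 1 of blocks except the degenerate Ω₀ = a single 2^d-site cube (L = 2, K = 1); the periodic
4-cycle exception of part 2 does not occur.  The conclusion of (b) thus holds in the scalar model exactly as worded
after the erratum of part 1, and nothing downstream changes (Sect. E uses only Q′H′ = I).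

HONEST SCOPE.  As in parts 1–2: scalar model (𝔤 = ℝ, U flat), block sums ≡ block means; Ω₀ is taken to be a box
of K blocks per direction (p. 394 allows any union of big blocks; other shapes are covered only by the general
`crit_iff` / `crit_iff_of_noCross` of part 1); no bound, no row head changes.

Sources: [Balaban1985RegularSpaces] (1.91) p. 91 [PDF 17]; [Balaban1985BackgroundPropagators] (3.18)–(3.19) p. 393,
(3.21)–(3.25) and the Dirichlet paragraph p. 394, (3.162)–(3.165) p. 429 [PDF 5, 6, 41] (OCR pages p0005, p0006,
p0041 of `paper:balaban1985-cmp99-background-propagators`).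
-/

namespace Literature.MathematicalPhysics.QuantumFieldTheory.Balaban1983to89.B8Eq194CriterionDirichlet

open Finset Literature.MathematicalPhysics.QuantumFieldTheory.Balaban1983to89.B8Eq194Criterion
  Literature.MathematicalPhysics.QuantumFieldTheory.Balaban1983to89.B8Eq194CriterionTorus

/-- Nearest-neighbour bond weights INSIDE the chain Ω₀ = {0, …, N−1} ⊂ ℤ (no wrap-around).
[cite: Balaban1985BackgroundPropagators, (3.23) p. 394] -/
def pathW (N : ℕ) (x y : Fin N) : ℝ := if (y.val = x.val + 1 ∨ x.val = y.val + 1) then 1 else 0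

/-- The Dirichlet diagonal term of the chain: m(x) = number of bonds of ℤ leaving Ω₀ at x (one at each end site; two
when N = 1). [cite: Balaban1985BackgroundPropagators, (3.23) p. 394 («Dirichlet boundary conditions on ∂Ω₀»)] -/
def endM (N : ℕ) (x : Fin N) : ℝ := (if x.val = 0 then 1 else 0) + (if x.val + 1 = N then 1 else 0)

/-- helper: `pathW` is symmetric. [folklore] -/
private theorem pathW_symm {N : ℕ} (x y : Fin N) : pathW N x y = pathW N y x := by
  simp only [pathW, or_comm]

/-- helper: `pathW` is non-negative. [folklore] -/
private theorem pathW_nonneg {N : ℕ} (x y : Fin N) : 0 ≤ pathW N x y := by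
  unfold pathW; split_ifs <;> norm_num

/-- helper: within a single block (N ≤ L) no bond joins two blocks. [folklore] -/
private theorem noCross_of_le {N L : ℕ} (hNL : N ≤ L) (x y : Fin N) (hne : cycBlk L x ≠ cycBlk L y) :
    pathW N x y = 0 :=
  (hne (by
    have := x.isLt; have := y.isLt
    show x.val / L = y.val / L
    rw [Nat.div_eq_of_lt (by omega), Nat.div_eq_of_lt (by omega)])).elim

/-- L = 1 (one-site blocks): the criterion holds on the Dirichlet chain. [cite: Balaban1985BackgroundPropagators,
(3.163)–(3.165) p. 429; Balaban1985RegularSpaces, (1.91) p. 91] -/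
theorem crit_dir_one (N : ℕ) : Crit (pathW N) (endM N) (cycBlk (N := N) 1) := crit_cyc_one _ _

/-- Ω₀ = ONE block of two sites ((L, K) = (2, 1)): the criterion HOLDS (both sites carry one leaving bond, m ≡ 1).
[cite: Balaban1985BackgroundPropagators, (3.23) p. 394, (3.163)–(3.165) p. 429] -/
theorem crit_dir_two_one {N : ℕ} (hN : N = 2) : Crit (pathW N) (endM N) (cycBlk (N := N) 2) := by
  subst hN
  refine (crit_iff_of_noCross pathW_symm (noCross_of_le le_rfl)).2 fun x y _ => ?_
  fin_cases x <;> fin_cases y <;> norm_num [endM]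

/-- Ω₀ = ONE block of L ≥ 3 sites (K = 1): the criterion FAILS — the end site carries a leaving bond, its neighbour
does not (m not constant on the block). [cite: Balaban1985BackgroundPropagators, (3.23) p. 394, (3.163)–(3.165)
p. 429; Balaban1985RegularSpaces, (1.91) p. 91] -/
theorem not_crit_dir_single {N L : ℕ} (hN : N = L) (hL : 3 ≤ L) : ¬ Crit (pathW N) (endM N) (cycBlk (N := N) L) := by
  subst hN
  intro h
  have key := (crit_iff_of_noCross pathW_symm (noCross_of_le le_rfl)).1 h ⟨0, by omega⟩ ⟨1, by omega⟩ (by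
    show 0 / N = 1 / N
    rw [Nat.div_eq_of_lt (by omega), Nat.div_eq_of_lt (by omega)])
  change ((if (0 : ℕ) = 0 then (1 : ℝ) else 0) + (if 0 + 1 = N then (1 : ℝ) else 0))
      = ((if (1 : ℕ) = 0 then (1 : ℝ) else 0) + (if 1 + 1 = N then (1 : ℝ) else 0)) at key
  rw [if_pos rfl, if_neg (by omega), if_neg (by omega), if_neg (by omega)] at key
  norm_num at key

/-- L ≥ 3 and K ≥ 2 blocks: the criterion FAILS (the last site of block 0 has a neighbour in block 1, the second
site has none). [cite: Balaban1985RegularSpaces, (1.91) p. 91; Balaban1985BackgroundPropagators, (3.163)–(3.165)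
p. 429] -/
theorem not_crit_dir_three {N L K : ℕ} (hN : N = L * K) (hL : 3 ≤ L) (hK : 2 ≤ K) :
    ¬ Crit (pathW N) (endM N) (cycBlk (N := N) L) := by
  subst hN
  have hLK : 2 * L ≤ L * K := by nlinarith
  have hxN : L - 1 < L * K := by omega
  have h1N : 1 < L * K := by omega
  have hLN : L < L * K := by omega
  intro h
  have key := crit_iff.1 h 1 ⟨L - 1, hxN⟩ ⟨1, h1N⟩ (by
    show (L - 1) / L = 1 / L
    rw [Nat.div_eq_of_lt (by omega), Nat.div_eq_of_lt (by omega)])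
  have hA : ∑ y ∈ univ with cycBlk L y = 1, pathW (L * K) y ⟨1, h1N⟩ = 0 := by
    refine Finset.sum_eq_zero fun y hy => ?_
    have hy1 : y.val / L = 1 := (mem_filter.1 hy).2
    have hyL : L ≤ y.val := by
      by_contra hlt
      rw [Nat.div_eq_of_lt (by omega)] at hy1
      omega
    show (if ((1 : ℕ) = y.val + 1 ∨ y.val = 1 + 1) then (1 : ℝ) else 0) = 0
    rw [if_neg (by omega)]
  have hB : (1 : ℝ) ≤ ∑ y ∈ univ with cycBlk L y = 1, pathW (L * K) y ⟨L - 1, hxN⟩ := by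
    have hmem : (⟨L, hLN⟩ : Fin (L * K)) ∈ (univ.filter fun y : Fin (L * K) => cycBlk L y = 1) := by
      rw [mem_filter]
      exact ⟨mem_univ _, by show L / L = 1; exact Nat.div_self (by omega)⟩
    refine le_trans ?_ (Finset.single_le_sum (f := fun y => pathW (L * K) y ⟨L - 1, hxN⟩)
      (fun y _ => pathW_nonneg y _) hmem)
    show (1 : ℝ) ≤ (if ((L - 1 : ℕ) = L + 1 ∨ (L : ℕ) = L - 1 + 1) then (1 : ℝ) else 0)
    rw [if_pos (Or.inr (by omega))]
  rw [coef_of_ne (show ¬ (cycBlk L (⟨L - 1, hxN⟩ : Fin (L * K)) = 1) by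
      show ¬ ((L - 1) / L = 1); rw [Nat.div_eq_of_lt (by omega)]; omega),
    coef_of_ne (show ¬ (cycBlk L (⟨1, h1N⟩ : Fin (L * K)) = 1) by
      show ¬ (1 / L = 1); rw [Nat.div_eq_of_lt (by omega)]; omega), hA, neg_zero] at key
  linarith

/-- L = 2 and K ≥ 2 blocks: the criterion FAILS (site 1 has the neighbour 2 in block 1, site 0 has none — its other
bond leaves Ω₀). [cite: Balaban1985RegularSpaces, (1.91) p. 91; Balaban1985BackgroundPropagators, (3.163)–(3.165)
p. 429] -/
theorem not_crit_dir_two {N K : ℕ} (hN : N = 2 * K) (hK : 2 ≤ K) :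
    ¬ Crit (pathW N) (endM N) (cycBlk (N := N) 2) := by
  subst hN
  have h0 : 0 < 2 * K := by omega
  have h1 : 1 < 2 * K := by omega
  have h2 : 2 < 2 * K := by omega
  intro h
  have key := crit_iff.1 h 1 ⟨1, h1⟩ ⟨0, h0⟩ (by show 1 / 2 = 0 / 2; norm_num)
  have hA : ∑ y ∈ univ with cycBlk 2 y = 1, pathW (2 * K) y ⟨0, h0⟩ = 0 := by
    refine Finset.sum_eq_zero fun y hy => ?_
    have hy1 : y.val / 2 = 1 := (mem_filter.1 hy).2
    show (if ((0 : ℕ) = y.val + 1 ∨ y.val = 0 + 1) then (1 : ℝ) else 0) = 0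
    rw [if_neg (by omega)]
  have hB : (1 : ℝ) ≤ ∑ y ∈ univ with cycBlk 2 y = 1, pathW (2 * K) y ⟨1, h1⟩ := by
    have hmem : (⟨2, h2⟩ : Fin (2 * K)) ∈ (univ.filter fun y : Fin (2 * K) => cycBlk 2 y = 1) := by
      rw [mem_filter]
      exact ⟨mem_univ _, by show 2 / 2 = 1; norm_num⟩
    refine le_trans ?_ (Finset.single_le_sum (f := fun y => pathW (2 * K) y ⟨1, h1⟩)
      (fun y _ => pathW_nonneg y _) hmem)
    show (1 : ℝ) ≤ (if ((1 : ℕ) = 2 + 1 ∨ (2 : ℕ) = 1 + 1) then (1 : ℝ) else 0)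
    rw [if_pos (Or.inr rfl)]
  rw [coef_of_ne (show ¬ (cycBlk 2 (⟨1, h1⟩ : Fin (2 * K)) = 1) by show ¬ (1 / 2 = 1); norm_num),
    coef_of_ne (show ¬ (cycBlk 2 (⟨0, h0⟩ : Fin (2 * K)) = 1) by show ¬ (0 / 2 = 1); norm_num),
    hA, neg_zero] at key
  linarith

/-- **Classification on the Dirichlet chain** Ω₀ = {0, …, LK − 1} ⊂ ℤ with K blocks of L consecutive sites,
nearest-neighbour Laplacian with Dirichlet boundary conditions on ∂Ω₀ ([4] p. 394):
Q′ΔN(Q′) = 0 ⟺ L = 1 ∨ (L, K) = (2, 1). [cite: Balaban1985RegularSpaces, (1.91) p. 91;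
Balaban1985BackgroundPropagators, (3.23) p. 394, (3.163)–(3.165) p. 429] -/
theorem crit_dir_chain_iff {N L K : ℕ} (hN : N = L * K) (hL : 1 ≤ L) (hK : 1 ≤ K) :
    Crit (pathW N) (endM N) (cycBlk (N := N) L) ↔ (L = 1 ∨ (L = 2 ∧ K = 1)) := by
  constructor
  · intro h
    by_contra hne
    rcases Nat.lt_or_ge L 3 with hL3 | hL3
    · obtain rfl : L = 2 := by omega
      exact not_crit_dir_two hN (by omega) h
    · rcases Nat.lt_or_ge K 2 with hK2 | hK2
      · obtain rfl : K = 1 := by omega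
        exact not_crit_dir_single (by rw [hN, Nat.mul_one]) hL3 h
      · exact not_crit_dir_three hN hL3 hK2 h
  · rintro (hL1 | ⟨hL2, hK1⟩)
    · subst hL1; exact crit_dir_one _
    · subst hL2; subst hK1; exact crit_dir_two_one (by rw [hN])

/-- **Classification on the Dirichlet box** Ω₀ = {0, …, LK − 1}^ι ⊂ ℤ^ι (ι ≠ ∅ finite: the d directions), the
Kronecker-sum (= d-dimensional nearest-neighbour) Laplacian with Dirichlet boundary conditions on ∂Ω₀ and the
K^d cubic blocks of side L — the setting of [4] p. 394 / [B8] (1.91) in the scalar model: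
Q′ΔN(Q′) = 0 ⟺ L = 1 ∨ (L, K) = (2, 1); i.e. for every L ≥ 2 the operator (1.91) differs from [4]'s (3.163)
unless Ω₀ is a single 2^d-site cube. [cite: Balaban1985RegularSpaces, (1.91) p. 91;
Balaban1985BackgroundPropagators, (3.23) p. 394, (3.163)–(3.165) p. 429] -/
theorem crit_dir_box_iff {ι : Type*} [Fintype ι] [DecidableEq ι] [Nonempty ι] {N L K : ℕ} (hN : N = L * K)
    (hL : 1 ≤ L) (hK : 1 ≤ K) :
    Crit (piW fun _ : ι => pathW N) (piM fun _ : ι => endM N) (piBlk fun _ : ι => cycBlk (N := N) L)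
      ↔ (L = 1 ∨ (L = 2 ∧ K = 1)) := by
  haveI : Nonempty (Fin N) := ⟨⟨0, by rw [hN]; exact Nat.mul_pos hL hK⟩⟩
  rw [crit_pi_iff]
  exact (forall_const ι).trans (crit_dir_chain_iff hN hL hK)

/-- [4] p. 394's example, Ω₀ = one block of three sites (by hand in `B8Eq194FirstTerm` §2; the same system as
`B8Eq194Criterion.not_crit_dirichlet3`, here as an instance of the classification).
[cite: Balaban1985BackgroundPropagators, (3.23) p. 394] -/
theorem not_crit_dir_three_sites : ¬ Crit (pathW 3) (endM 3) (cycBlk (N := 3) 3) :=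
  not_crit_dir_single rfl le_rfl

end Literature.MathematicalPhysics.QuantumFieldTheory.Balaban1983to89.B8Eq194CriterionDirichlet
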